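import Summits.Ventures.CertifiedManyBodySolver.Certificates.HubbardSquare_n7o8_pinning_menuA0_responseCeilingM_pricedNodes
import Summits.Ventures.CertifiedManyBodySolver.Certificates.HubbardSquare_n7o8_pinning_menuA0p_responseCeilingM_pricedNodes
import Literature.MathematicalPhysics.QuantumLattice.DWaveSourceCapClassTPrimeTransport
import HarnessLib
import HarnessLib.Audit

/-!
# Ventures/CertifiedManyBodySolver — Certificates/HubbardSquare_n7o8_pinning_menus_tPrimeBox_pairAmpCeilings.lean

HONEST FRAMING: first certified bounds; not a superconductivity verdict; every number certified or labelled float. A CEILING on a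
`d`-wave pair amplitude never speaks to the presence or absence of order; no phase sentence; CANDIDATE until the named nodes are
referee-replayed. WHAT-THIS-IS-NOT: a floor; a number of record beyond its named premises; a statement at any `U ≠ 8` below the anchor.

THE FIRST `t'`-BOX PAIR-AMPLITUDE CEILINGS (stage S2 «points → boxes» for the ORDER word; seat hubbard-box-p3, cell
`pub/hubbard-fast`, row «`t'`-boxes transport from the `t' ∈ {0, −1/4}` anchors»). INPUTS BY NAME: (i) hubbard-obs-pin-1's PRICED
menu nodes (`…menuA0_responseCeilingM_pricedNodes.lean` p485396: pilot-2's A0 = (8, 7/8, −1/4) menu L1/L2/L3, nine fields;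
`…menuA0p_responseCeilingM_pricedNodes.lean` p485461: pilot-1's A0′ = (8, 7/8, 0) menu M1–M5): «∀ σ TI, density 7/8:
√2·Re σ(P₀^d) ≤ M̃ + κ·(E^{src}_{anchor,h}(σ) − hi)», κ the cap row's exact multiplier; (ii) the anchor caps #445 / #354
(`cert_dbt329pair_allk`, `cert_dbt299pair_allk`); (iii) the Literature transport law `canonicalMinimiser_le_priced_of_capClass_tPrime`
(`DWaveSourceCapClassTPrimeTransport.lean` p484647/p485607): a density-`n` sourced minimiser at `t'` has anchor energy
`≤ R(t') + (16/π²)|t'₀ − t'|`, `R(t')` any canonical cap at the target — here the REGISTRY-ONLY kinematic transport of the anchor cap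
itself, `R(t') = hi + (16/π²)|t' − t'₀|` (`energyDensityTT'_le_of_upperBound_tPrime_kinematic`), so the total price is
`κ·2·(16/π²)·|t' − t'₀| < κ·3.2424·|t' − t'₀|` and NO `K₂` word is consumed. OUTPUT (§1 generic, §2 A0 on the cuprate `t'`-box
`[−3/10, −1/5]` = the box of record's `t'`-extent `−0.25 ± 0.05`, §3 A0′ on `[−1/20, 1/20]`), per node: «every translation-invariant
density-7/8 minimiser of the `d`-wave-SOURCED energy at field `h` and ANY `t'` of the box (U = 8) has `Re ω(P₀^d) ≤ M_box`»; at
`h = 0` (A0 L2 g = 0) the minimisers are the translation-invariant density-7/8 GROUND STATES of the UNSOURCED `t–t'` Hubbard model, so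
§2's first theorem reads: **for every `t' ∈ [−0.30, −0.20]`, every such ground state at `(U, n) = (8, 7/8)` has `d`-wave pair amplitude
`Re ω(P₀^d) ≤ 0.8964936`** (anchor value `0.7600015` at `t' = −1/4`). Slots `M_box = ⌈(M̃ + κ·0.16212)/1.41421356⌉₇`. Sharper editions
(target caps from `K₂` words: excess `0.1354` instead of `0.16212`; the `U`-extent `[8, 8.5]` free by `…_tPrime_U`) are one-line variants
of §1 left to the consumers. Generated by hand (hubbard-box-p3 g4) from the exact node rationals.

References: T. Koma, H. Tasaki, J. Stat. Phys. 76 (1994) 745 §1; J. Wang et al., Phys. Rev. X 14 (2024) 031006 §III (Lagrangian reading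
of a relaxation certificate); E. H. Lieb, M. Loss, Duke Math. J. 71 (1993) 337 §8 (the `16/π²` row).
-/

noncomputable section

namespace Summit.Ventures.CertifiedManyBodySolver.Certificates

open Literature.MathematicalPhysics.QuantumLattice Literature.MathematicalPhysics.QuantumLattice.ThermodynamicLimit
open Literature.Probability.LatticeModels HubbardWave0 InfVolFermionState
open Summit.Ventures.CertifiedManyBodySolver
open scoped ComplexOrder

/-! ### §1 Generic: a priced menu node + the anchor's canonical cap ⇒ a pair-amplitude ceiling on a `t'`-box (kinematic, registry-only) -/

/-- `16/π² < 1.6212` (from `π > 3.141592`). -/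
theorem sixteen_div_pi_sq_lt_decimal : 16 / Real.pi ^ 2 < (1.6212 : ℝ) := by
  have hπ := Real.pi_gt_d6
  have hπ2 : (3.141592 : ℝ) ^ 2 < Real.pi ^ 2 := by
    have h0 : (0 : ℝ) ≤ 3.141592 := by norm_num
    nlinarith
  rw [div_lt_iff₀ (by positivity)]
  nlinarith

/-- **`t'`-BOX PAIR-AMPLITUDE CEILING FROM ONE PRICED MENU NODE (kinematic, registry-only)**: a priced class sentence at the
anchor `(t'₀, U, h)` («√2·Re σ(P₀^d) ≤ M̃ + κ·(E^{src}_{t'₀,U,h}(σ) − u₀)» for all TI density-`n` `σ`, `κ ≥ 0`), the anchor's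
canonical cap `e(1,t'₀,U;n) ≤ u₀` and a slot inequality `M̃ + κ·(2·1.6212·r) ≤ M·1.41421356` give `Re ω(P₀^d) ≤ M` for every
density-`n` sourced minimiser at every `t'` with `|t'₀ − t'| ≤ r` (the anchor cap moved kinematically to the target is the target cap;
the target state's anchor energy pays the second `16/π²`). Ceiling only. -/
theorem pairAmp_le_slot_on_tPrimeBox_kinematic_of_pricedNode {t'₀ U n h u₀ Mt κ r M : ℝ} (hU : 0 ≤ U) (hn0 : 0 ≤ n)
    (hn2 : n < 2) (hκ : 0 ≤ κ) (hM : 0 ≤ M)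
    (hP : ∀ σ : InfVolFermionState 2, σ.IsTranslationInvariant → σ.density = n →
      Real.sqrt 2 * (σ.expect (pairRegion (insert 0 unitSteps) 0) (localPairAt (insert 0 unitSteps) dWaveFormFactor 0)).re ≤
        Mt + κ * (σ.meanEnergy (hubbardTTPrimeSourcedInteraction 1 t'₀ U 0 dWaveFormFactor h) 1 - u₀))
    (hcap : energyDensityTT' 1 t'₀ U n ≤ u₀) (hslot : Mt + κ * (2 * 1.6212 * r) ≤ M * (141421356 / 100000000 : ℝ))
    {t' : ℝ} (ht : |t'₀ - t'| ≤ r)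
    {ω : InfVolFermionState 2} (hω : ω.IsTranslationInvariant) (hρ : ω.density = n)
    (hmin : ∀ ω' : InfVolFermionState 2, ω'.IsTranslationInvariant → ω'.density = n →
      ω.meanEnergy (hubbardTTPrimeSourcedInteraction 1 t' U 0 dWaveFormFactor h) 1 ≤
        ω'.meanEnergy (hubbardTTPrimeSourcedInteraction 1 t' U 0 dWaveFormFactor h) 1) :
    (ω.expect (pairRegion (insert 0 unitSteps) 0) (localPairAt (insert 0 unitSteps) dWaveFormFactor 0)).re ≤ M := by
  have hR := energyDensityTT'_le_of_upperBound_tPrime_kinematic 1 hU hn0 hn2 (s := t'₀) (s' := t') hcap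
  have key := canonicalMinimiser_le_priced_of_capClass_tPrime
    (f := fun σ => Real.sqrt 2 * (σ.expect (pairRegion (insert 0 unitSteps) 0)
      (localPairAt (insert 0 unitSteps) dWaveFormFactor 0)).re) hU hn0 hn2 hκ hP hR hω hρ hmin
  have hpi := sixteen_div_pi_sq_lt_decimal
  have habs : |t' - t'₀| = |t'₀ - t'| := abs_sub_comm _ _
  rw [habs] at key
  have hκ2 : κ * (u₀ + 16 / Real.pi ^ 2 * |t'₀ - t'| + 16 / Real.pi ^ 2 * |t'₀ - t'| - u₀) ≤ κ * (2 * 1.6212 * r) := by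
    apply mul_le_mul_of_nonneg_left _ hκ
    have h0 : 0 ≤ |t'₀ - t'| := abs_nonneg _
    nlinarith [mul_le_mul_of_nonneg_left ht (show (0:ℝ) ≤ 1.6212 by norm_num),
      mul_le_mul_of_nonneg_right hpi.le h0]
  exact le_slot_of_sqrt_two_mul_le (by simpa using key.trans (by linarith)) hM hslot

/-! ### §2 A0 = (8, 7/8, −1/4): the cuprate `t'`-box `[−3/10, −1/5]` (nine fields of pilot-2's menu) -/

/-- **ORDER-PARAMETER CLASS `t'`-BOX CEILING from node `cert_pin2_A0menu_L2_U8_n7o8_tpm1o4_g0_pairAmpMax_priced_j256528`** (A0 = (8, 7/8, −1/4); M̃ = 1.0748043095, κ = 1.19066; anchor slot 0.7600015): for every `t' ∈ [−0.30, −0.20]` (U = 8), every translation-invariant density-7/8 GROUND STATE of the unsourced `t–t'` Hubbard model (the sourced minimisers at `h = 0`) has **`Re ω(P₀^d) ≤ 0.8964936`** (slot `1120617/1250000` = ⌈(M̃ + κ·2·1.6212/20)/1.41421356⌉₇; kinematic registry-only route: anchor cap #445 moved to the target at `16/π²`, target state's anchor energy `+16/π²·|Δt'|`). Premises BY NAME: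 the priced node (CANDIDATE, referee pending) and #445. Ceiling only; never speaks to presence; no phase sentence. -/
theorem pin2_A0menu_L2_U8_n7o8_tpm1o4_g0_j256528_pairAmp_le_on_tPrimeBox_of_pricedNode
    (hP : cert_pin2_A0menu_L2_U8_n7o8_tpm1o4_g0_pairAmpMax_priced_j256528) (h445 : cert_dbt329pair_allk)
    {t' : ℝ} (ht : t' ∈ Set.Icc (-3/10 : ℝ) (-1/5))
    {ω : InfVolFermionState 2} (hω : ω.IsTranslationInvariant) (hρ : ω.density = 7 / 8)
    (hmin : ∀ ω' : InfVolFermionState 2, ω'.IsTranslationInvariant → ω'.density = 7 / 8 →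
      ω.meanEnergy (hubbardTTPrimeSourcedInteraction 1 t' 8 0 dWaveFormFactor 0) 1 ≤
        ω'.meanEnergy (hubbardTTPrimeSourcedInteraction 1 t' 8 0 dWaveFormFactor 0) 1) :
    (ω.expect (pairRegion (insert 0 unitSteps) 0) (localPairAt (insert 0 unitSteps) dWaveFormFactor 0)).re ≤
      (((1120617/1250000 : ℚ)) : ℝ) := by
  have hr : |((-1/4) : ℝ) - t'| ≤ 1 / 20 := by
    rw [abs_le]; constructor <;> linarith [ht.1, ht.2]
  exact pairAmp_le_slot_on_tPrimeBox_kinematic_of_pricedNode (t'₀ := (-1/4)) (by norm_num) (by norm_num) (by norm_num)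
    (by norm_num) (by norm_num) hP (energyDensityTT'_le_hi445_of_node h445) (by norm_num) hr hω hρ hmin

/-- **`t'`-BOX CEILING from node `cert_pin2_A0menu_L2_U8_n7o8_tpm1o4_g1o112_pairAmpMax_priced_j256528`** (A0 = (8, 7/8, −1/4); M̃ = 1.0977214376, κ = 1.17220; anchor slot 0.7762063): for every `t' ∈ [−0.30, −0.20]` (U = 8), every translation-invariant density-7/8 minimiser of the `d`-wave-sourced energy at field `h = (√2 * (1/112 : ℝ))` has **`Re ω(P₀^d) ≤ 0.9105827`** (slot `9105827/10000000` = ⌈(M̃ + κ·2·1.6212/20)/1.41421356⌉₇; kinematic registry-only route: anchor cap #445 moved to the target at `16/π²`, target state's anchor energy `+16/π²·|Δt'|`). Premises BY NAME: the priced node (CANDIDATE, referee pending) and #445. Ceiling only; never speaks to presence; no phase sentence. -/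
theorem pin2_A0menu_L2_U8_n7o8_tpm1o4_g1o112_j256528_pairAmp_le_on_tPrimeBox_of_pricedNode
    (hP : cert_pin2_A0menu_L2_U8_n7o8_tpm1o4_g1o112_pairAmpMax_priced_j256528) (h445 : cert_dbt329pair_allk)
    {t' : ℝ} (ht : t' ∈ Set.Icc (-3/10 : ℝ) (-1/5))
    {ω : InfVolFermionState 2} (hω : ω.IsTranslationInvariant) (hρ : ω.density = 7 / 8)
    (hmin : ∀ ω' : InfVolFermionState 2, ω'.IsTranslationInvariant → ω'.density = 7 / 8 →
      ω.meanEnergy (hubbardTTPrimeSourcedInteraction 1 t' 8 0 dWaveFormFactor (Real.sqrt 2 * (1/112 : ℝ))) 1 ≤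
        ω'.meanEnergy (hubbardTTPrimeSourcedInteraction 1 t' 8 0 dWaveFormFactor (Real.sqrt 2 * (1/112 : ℝ))) 1) :
    (ω.expect (pairRegion (insert 0 unitSteps) 0) (localPairAt (insert 0 unitSteps) dWaveFormFactor 0)).re ≤
      (((9105827/10000000 : ℚ)) : ℝ) := by
  have hr : |((-1/4) : ℝ) - t'| ≤ 1 / 20 := by
    rw [abs_le]; constructor <;> linarith [ht.1, ht.2]
  exact pairAmp_le_slot_on_tPrimeBox_kinematic_of_pricedNode (t'₀ := (-1/4)) (by norm_num) (by norm_num) (by norm_num)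
    (by norm_num) (by norm_num) hP (energyDensityTT'_le_hi445_of_node h445) (by norm_num) hr hω hρ hmin

/-- **`t'`-BOX CEILING from node `cert_pin2_A0menu_L2_U8_n7o8_tpm1o4_g1o56_pairAmpMax_priced_j256528`** (A0 = (8, 7/8, −1/4); M̃ = 1.1207504071, κ = 1.15301; anchor slot 0.7924903): for every `t' ∈ [−0.30, −0.20]` (U = 8), every translation-invariant density-7/8 minimiser of the `d`-wave-sourced energy at field `h = (√2 * (1/56 : ℝ))` has **`Re ω(P₀^d) ≤ 0.9246671`** (slot `9246671/10000000` = ⌈(M̃ + κ·2·1.6212/20)/1.41421356⌉₇; kinematic registry-only route: anchor cap #445 moved to the target at `16/π²`, target state's anchor energy `+16/π²·|Δt'|`). Premises BY NAME: the priced node (CANDIDATE, referee pending) and #445. Ceiling only; never speaks to presence; no phase sentence. -/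
theorem pin2_A0menu_L2_U8_n7o8_tpm1o4_g1o56_j256528_pairAmp_le_on_tPrimeBox_of_pricedNode
    (hP : cert_pin2_A0menu_L2_U8_n7o8_tpm1o4_g1o56_pairAmpMax_priced_j256528) (h445 : cert_dbt329pair_allk)
    {t' : ℝ} (ht : t' ∈ Set.Icc (-3/10 : ℝ) (-1/5))
    {ω : InfVolFermionState 2} (hω : ω.IsTranslationInvariant) (hρ : ω.density = 7 / 8)
    (hmin : ∀ ω' : InfVolFermionState 2, ω'.IsTranslationInvariant → ω'.density = 7 / 8 →
      ω.meanEnergy (hubbardTTPrimeSourcedInteraction 1 t' 8 0 dWaveFormFactor (Real.sqrt 2 * (1/56 : ℝ))) 1 ≤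
        ω'.meanEnergy (hubbardTTPrimeSourcedInteraction 1 t' 8 0 dWaveFormFactor (Real.sqrt 2 * (1/56 : ℝ))) 1) :
    (ω.expect (pairRegion (insert 0 unitSteps) 0) (localPairAt (insert 0 unitSteps) dWaveFormFactor 0)).re ≤
      (((9246671/10000000 : ℚ)) : ℝ) := by
  have hr : |((-1/4) : ℝ) - t'| ≤ 1 / 20 := by
    rw [abs_le]; constructor <;> linarith [ht.1, ht.2]
  exact pairAmp_le_slot_on_tPrimeBox_kinematic_of_pricedNode (t'₀ := (-1/4)) (by norm_num) (by norm_num) (by norm_num)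
    (by norm_num) (by norm_num) hP (energyDensityTT'_le_hi445_of_node h445) (by norm_num) hr hω hρ hmin

/-- **`t'`-BOX CEILING from node `cert_pin2_A0menu_L2_U8_n7o8_tpm1o4_g1o28_pairAmpMax_priced_j256528`** (A0 = (8, 7/8, −1/4); M̃ = 1.1670286855, κ = 1.11242; anchor slot 0.8252139): for every `t' ∈ [−0.30, −0.20]` (U = 8), every translation-invariant density-7/8 minimiser of the `d`-wave-sourced energy at field `h = (√2 * (1/28 : ℝ))` has **`Re ω(P₀^d) ≤ 0.9527379`** (slot `9527379/10000000` = ⌈(M̃ + κ·2·1.6212/20)/1.41421356⌉₇; kinematic registry-only route: anchor cap #445 moved to the target at `16/π²`, target state's anchor energy `+16/π²·|Δt'|`). Premises BY NAME: the priced node (CANDIDATE, referee pending) and #445. Ceiling only; never speaks to presence; no phase sentence. -/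
theorem pin2_A0menu_L2_U8_n7o8_tpm1o4_g1o28_j256528_pairAmp_le_on_tPrimeBox_of_pricedNode
    (hP : cert_pin2_A0menu_L2_U8_n7o8_tpm1o4_g1o28_pairAmpMax_priced_j256528) (h445 : cert_dbt329pair_allk)
    {t' : ℝ} (ht : t' ∈ Set.Icc (-3/10 : ℝ) (-1/5))
    {ω : InfVolFermionState 2} (hω : ω.IsTranslationInvariant) (hρ : ω.density = 7 / 8)
    (hmin : ∀ ω' : InfVolFermionState 2, ω'.IsTranslationInvariant → ω'.density = 7 / 8 →
      ω.meanEnergy (hubbardTTPrimeSourcedInteraction 1 t' 8 0 dWaveFormFactor (Real.sqrt 2 * (1/28 : ℝ))) 1 ≤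
        ω'.meanEnergy (hubbardTTPrimeSourcedInteraction 1 t' 8 0 dWaveFormFactor (Real.sqrt 2 * (1/28 : ℝ))) 1) :
    (ω.expect (pairRegion (insert 0 unitSteps) 0) (localPairAt (insert 0 unitSteps) dWaveFormFactor 0)).re ≤
      (((9527379/10000000 : ℚ)) : ℝ) := by
  have hr : |((-1/4) : ℝ) - t'| ≤ 1 / 20 := by
    rw [abs_le]; constructor <;> linarith [ht.1, ht.2]
  exact pairAmp_le_slot_on_tPrimeBox_kinematic_of_pricedNode (t'₀ := (-1/4)) (by norm_num) (by norm_num) (by norm_num)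
    (by norm_num) (by norm_num) hP (energyDensityTT'_le_hi445_of_node h445) (by norm_num) hr hω hρ hmin

/-- **`t'`-BOX CEILING from node `cert_pin2_A0menu_L2_U8_n7o8_tpm1o4_g1o14_pairAmpMax_priced_j256528`** (A0 = (8, 7/8, −1/4); M̃ = 1.2596132911, κ = 1.02369; anchor slot 0.8906812): for every `t' ∈ [−0.30, −0.20]` (U = 8), every translation-invariant density-7/8 minimiser of the `d`-wave-sourced energy at field `h = (√2 * (1/14 : ℝ))` has **`Re ω(P₀^d) ≤ 1.0080328`** (slot `1260041/1250000` = ⌈(M̃ + κ·2·1.6212/20)/1.41421356⌉₇; kinematic registry-only route: anchor cap #445 moved to the target at `16/π²`, target state's anchor energy `+16/π²·|Δt'|`). Premises BY NAME: the priced node (CANDIDATE, referee pending) and #445. Ceiling only; never speaks to presence; no phase sentence. -/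
theorem pin2_A0menu_L2_U8_n7o8_tpm1o4_g1o14_j256528_pairAmp_le_on_tPrimeBox_of_pricedNode
    (hP : cert_pin2_A0menu_L2_U8_n7o8_tpm1o4_g1o14_pairAmpMax_priced_j256528) (h445 : cert_dbt329pair_allk)
    {t' : ℝ} (ht : t' ∈ Set.Icc (-3/10 : ℝ) (-1/5))
    {ω : InfVolFermionState 2} (hω : ω.IsTranslationInvariant) (hρ : ω.density = 7 / 8)
    (hmin : ∀ ω' : InfVolFermionState 2, ω'.IsTranslationInvariant → ω'.density = 7 / 8 →
      ω.meanEnergy (hubbardTTPrimeSourcedInteraction 1 t' 8 0 dWaveFormFactor (Real.sqrt 2 * (1/14 : ℝ))) 1 ≤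
        ω'.meanEnergy (hubbardTTPrimeSourcedInteraction 1 t' 8 0 dWaveFormFactor (Real.sqrt 2 * (1/14 : ℝ))) 1) :
    (ω.expect (pairRegion (insert 0 unitSteps) 0) (localPairAt (insert 0 unitSteps) dWaveFormFactor 0)).re ≤
      (((1260041/1250000 : ℚ)) : ℝ) := by
  have hr : |((-1/4) : ℝ) - t'| ≤ 1 / 20 := by
    rw [abs_le]; constructor <;> linarith [ht.1, ht.2]
  exact pairAmp_le_slot_on_tPrimeBox_kinematic_of_pricedNode (t'₀ := (-1/4)) (by norm_num) (by norm_num) (by norm_num)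
    (by norm_num) (by norm_num) hP (energyDensityTT'_le_hi445_of_node h445) (by norm_num) hr hω hρ hmin

/-- **`t'`-BOX CEILING from node `cert_pin2_A0menu_L2_U8_n7o8_tpm1o4_g1o7_pairAmpMax_priced_j256528`** (A0 = (8, 7/8, −1/4); M̃ = 1.4378503964, κ = 0.82559; anchor slot 1.0167138): for every `t' ∈ [−0.30, −0.20]` (U = 8), every translation-invariant density-7/8 minimiser of the `d`-wave-sourced energy at field `h = (√2 * (1/7 : ℝ))` has **`Re ω(P₀^d) ≤ 1.1113565`** (slot `2222713/2000000` = ⌈(M̃ + κ·2·1.6212/20)/1.41421356⌉₇; kinematic registry-only route: anchor cap #445 moved to the target at `16/π²`, target state's anchor energy `+16/π²·|Δt'|`). Premises BY NAME: the priced node (CANDIDATE, referee pending) and #445. Ceiling only; never speaks to presence; no phase sentence. -/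
theorem pin2_A0menu_L2_U8_n7o8_tpm1o4_g1o7_j256528_pairAmp_le_on_tPrimeBox_of_pricedNode
    (hP : cert_pin2_A0menu_L2_U8_n7o8_tpm1o4_g1o7_pairAmpMax_priced_j256528) (h445 : cert_dbt329pair_allk)
    {t' : ℝ} (ht : t' ∈ Set.Icc (-3/10 : ℝ) (-1/5))
    {ω : InfVolFermionState 2} (hω : ω.IsTranslationInvariant) (hρ : ω.density = 7 / 8)
    (hmin : ∀ ω' : InfVolFermionState 2, ω'.IsTranslationInvariant → ω'.density = 7 / 8 →
      ω.meanEnergy (hubbardTTPrimeSourcedInteraction 1 t' 8 0 dWaveFormFactor (Real.sqrt 2 * (1/7 : ℝ))) 1 ≤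
        ω'.meanEnergy (hubbardTTPrimeSourcedInteraction 1 t' 8 0 dWaveFormFactor (Real.sqrt 2 * (1/7 : ℝ))) 1) :
    (ω.expect (pairRegion (insert 0 unitSteps) 0) (localPairAt (insert 0 unitSteps) dWaveFormFactor 0)).re ≤
      (((2222713/2000000 : ℚ)) : ℝ) := by
  have hr : |((-1/4) : ℝ) - t'| ≤ 1 / 20 := by
    rw [abs_le]; constructor <;> linarith [ht.1, ht.2]
  exact pairAmp_le_slot_on_tPrimeBox_kinematic_of_pricedNode (t'₀ := (-1/4)) (by norm_num) (by norm_num) (by norm_num)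
    (by norm_num) (by norm_num) hP (energyDensityTT'_le_hi445_of_node h445) (by norm_num) hr hω hρ hmin

/-- **`t'`-BOX CEILING from node `cert_pin2_A0menu_L3_U8_n7o8_tpm1o4_g1o28_pairAmpMax_priced_j256530`** (A0 = (8, 7/8, −1/4); M̃ = 1.0259747516, κ = 1.46005; anchor slot 0.7254738): for every `t' ∈ [−0.30, −0.20]` (U = 8), every translation-invariant density-7/8 minimiser of the `d`-wave-sourced energy at field `h = (√2 * (1/28 : ℝ))` has **`Re ω(P₀^d) ≤ 0.8928482`** (slot `4464241/5000000` = ⌈(M̃ + κ·2·1.6212/20)/1.41421356⌉₇; kinematic registry-only route: anchor cap #445 moved to the target at `16/π²`, target state's anchor energy `+16/π²·|Δt'|`). Premises BY NAME: the priced node (CANDIDATE, referee pending) and #445. Ceiling only; never speaks to presence; no phase sentence. -/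
theorem pin2_A0menu_L3_U8_n7o8_tpm1o4_g1o28_j256530_pairAmp_le_on_tPrimeBox_of_pricedNode
    (hP : cert_pin2_A0menu_L3_U8_n7o8_tpm1o4_g1o28_pairAmpMax_priced_j256530) (h445 : cert_dbt329pair_allk)
    {t' : ℝ} (ht : t' ∈ Set.Icc (-3/10 : ℝ) (-1/5))
    {ω : InfVolFermionState 2} (hω : ω.IsTranslationInvariant) (hρ : ω.density = 7 / 8)
    (hmin : ∀ ω' : InfVolFermionState 2, ω'.IsTranslationInvariant → ω'.density = 7 / 8 →
      ω.meanEnergy (hubbardTTPrimeSourcedInteraction 1 t' 8 0 dWaveFormFactor (Real.sqrt 2 * (1/28 : ℝ))) 1 ≤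
        ω'.meanEnergy (hubbardTTPrimeSourcedInteraction 1 t' 8 0 dWaveFormFactor (Real.sqrt 2 * (1/28 : ℝ))) 1) :
    (ω.expect (pairRegion (insert 0 unitSteps) 0) (localPairAt (insert 0 unitSteps) dWaveFormFactor 0)).re ≤
      (((4464241/5000000 : ℚ)) : ℝ) := by
  have hr : |((-1/4) : ℝ) - t'| ≤ 1 / 20 := by
    rw [abs_le]; constructor <;> linarith [ht.1, ht.2]
  exact pairAmp_le_slot_on_tPrimeBox_kinematic_of_pricedNode (t'₀ := (-1/4)) (by norm_num) (by norm_num) (by norm_num)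
    (by norm_num) (by norm_num) hP (energyDensityTT'_le_hi445_of_node h445) (by norm_num) hr hω hρ hmin

/-- **`t'`-BOX CEILING from node `cert_pin2_A0menu_L3_U8_n7o8_tpm1o4_g1o7_pairAmpMax_priced_j256748`** (A0 = (8, 7/8, −1/4); M̃ = 1.3034890973, κ = 0.83703; anchor slot 0.9217060): for every `t' ∈ [−0.30, −0.20]` (U = 8), every translation-invariant density-7/8 minimiser of the `d`-wave-sourced energy at field `h = (√2 * (1/7 : ℝ))` has **`Re ω(P₀^d) ≤ 1.0176598`** (slot `5088299/5000000` = ⌈(M̃ + κ·2·1.6212/20)/1.41421356⌉₇; kinematic registry-only route: anchor cap #445 moved to the target at `16/π²`, target state's anchor energy `+16/π²·|Δt'|`). Premises BY NAME: the priced node (CANDIDATE, referee pending) and #445. Ceiling only; never speaks to presence; no phase sentence. -/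
theorem pin2_A0menu_L3_U8_n7o8_tpm1o4_g1o7_j256748_pairAmp_le_on_tPrimeBox_of_pricedNode
    (hP : cert_pin2_A0menu_L3_U8_n7o8_tpm1o4_g1o7_pairAmpMax_priced_j256748) (h445 : cert_dbt329pair_allk)
    {t' : ℝ} (ht : t' ∈ Set.Icc (-3/10 : ℝ) (-1/5))
    {ω : InfVolFermionState 2} (hω : ω.IsTranslationInvariant) (hρ : ω.density = 7 / 8)
    (hmin : ∀ ω' : InfVolFermionState 2, ω'.IsTranslationInvariant → ω'.density = 7 / 8 →
      ω.meanEnergy (hubbardTTPrimeSourcedInteraction 1 t' 8 0 dWaveFormFactor (Real.sqrt 2 * (1/7 : ℝ))) 1 ≤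
        ω'.meanEnergy (hubbardTTPrimeSourcedInteraction 1 t' 8 0 dWaveFormFactor (Real.sqrt 2 * (1/7 : ℝ))) 1) :
    (ω.expect (pairRegion (insert 0 unitSteps) 0) (localPairAt (insert 0 unitSteps) dWaveFormFactor 0)).re ≤
      (((5088299/5000000 : ℚ)) : ℝ) := by
  have hr : |((-1/4) : ℝ) - t'| ≤ 1 / 20 := by
    rw [abs_le]; constructor <;> linarith [ht.1, ht.2]
  exact pairAmp_le_slot_on_tPrimeBox_kinematic_of_pricedNode (t'₀ := (-1/4)) (by norm_num) (by norm_num) (by norm_num)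
    (by norm_num) (by norm_num) hP (energyDensityTT'_le_hi445_of_node h445) (by norm_num) hr hω hρ hmin

/-- **`t'`-BOX CEILING from node `cert_pin2_A0menu_L1_U8_n7o8_tpm1o4_g2o7_pairAmpMax_priced_j256748`** (A0 = (8, 7/8, −1/4); M̃ = 1.7452470849, κ = 0.30310; anchor slot 1.2340761): for every `t' ∈ [−0.30, −0.20]` (U = 8), every translation-invariant density-7/8 minimiser of the `d`-wave-sourced energy at field `h = (√2 * (2/7 : ℝ))` has **`Re ω(P₀^d) ≤ 1.2688218`** (slot `6344109/5000000` = ⌈(M̃ + κ·2·1.6212/20)/1.41421356⌉₇; kinematic registry-only route: anchor cap #445 moved to the target at `16/π²`, target state's anchor energy `+16/π²·|Δt'|`). Premises BY NAME: the priced node (CANDIDATE, referee pending) and #445. Ceiling only; never speaks to presence; no phase sentence. -/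
theorem pin2_A0menu_L1_U8_n7o8_tpm1o4_g2o7_j256748_pairAmp_le_on_tPrimeBox_of_pricedNode
    (hP : cert_pin2_A0menu_L1_U8_n7o8_tpm1o4_g2o7_pairAmpMax_priced_j256748) (h445 : cert_dbt329pair_allk)
    {t' : ℝ} (ht : t' ∈ Set.Icc (-3/10 : ℝ) (-1/5))
    {ω : InfVolFermionState 2} (hω : ω.IsTranslationInvariant) (hρ : ω.density = 7 / 8)
    (hmin : ∀ ω' : InfVolFermionState 2, ω'.IsTranslationInvariant → ω'.density = 7 / 8 →
      ω.meanEnergy (hubbardTTPrimeSourcedInteraction 1 t' 8 0 dWaveFormFactor (Real.sqrt 2 * (2/7 : ℝ))) 1 ≤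
        ω'.meanEnergy (hubbardTTPrimeSourcedInteraction 1 t' 8 0 dWaveFormFactor (Real.sqrt 2 * (2/7 : ℝ))) 1) :
    (ω.expect (pairRegion (insert 0 unitSteps) 0) (localPairAt (insert 0 unitSteps) dWaveFormFactor 0)).re ≤
      (((6344109/5000000 : ℚ)) : ℝ) := by
  have hr : |((-1/4) : ℝ) - t'| ≤ 1 / 20 := by
    rw [abs_le]; constructor <;> linarith [ht.1, ht.2]
  exact pairAmp_le_slot_on_tPrimeBox_kinematic_of_pricedNode (t'₀ := (-1/4)) (by norm_num) (by norm_num) (by norm_num)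
    (by norm_num) (by norm_num) hP (energyDensityTT'_le_hi445_of_node h445) (by norm_num) hr hω hρ hmin

/-! ### §3 A0′ = (8, 7/8, 0): the `t'`-box `[−1/20, 1/20]` (five fields of pilot-1's menu) -/

/-- **`t'`-BOX CEILING from node `cert_pin1_M1_gbT_T2union_s37_U8_n7o8_tp0_g1o28_pairAmpMax_priced_j256378`** (A0′ = (8, 7/8, 0); M̃ = 1.0156829894, κ = 1.43586; anchor slot 0.7181964): for every `t' ∈ [−0.05, 0.05]` (U = 8), every translation-invariant density-7/8 minimiser of the `d`-wave-sourced energy at field `h = (√2 * (1/28 : ℝ))` has **`Re ω(P₀^d) ≤ 0.8827975`** (slot `353119/400000` = ⌈(M̃ + κ·2·1.6212/20)/1.41421356⌉₇; kinematic registry-only route: anchor cap #354 moved to the target at `16/π²`, target state's anchor energy `+16/π²·|Δt'|`). Premises BY NAME: the priced node (CANDIDATE, referee pending) and #354. Ceiling only; never speaks to presence; no phase sentence. -/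
theorem pin1_M1_U8_n7o8_tp0_g1o28_j256378_pairAmp_le_on_tPrimeBox_of_pricedNode
    (hP : cert_pin1_M1_gbT_T2union_s37_U8_n7o8_tp0_g1o28_pairAmpMax_priced_j256378) (h354 : cert_dbt299pair_allk)
    {t' : ℝ} (ht : t' ∈ Set.Icc (-1/20 : ℝ) (1/20))
    {ω : InfVolFermionState 2} (hω : ω.IsTranslationInvariant) (hρ : ω.density = 7 / 8)
    (hmin : ∀ ω' : InfVolFermionState 2, ω'.IsTranslationInvariant → ω'.density = 7 / 8 →
      ω.meanEnergy (hubbardTTPrimeSourcedInteraction 1 t' 8 0 dWaveFormFactor (Real.sqrt 2 * (1/28 : ℝ))) 1 ≤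
        ω'.meanEnergy (hubbardTTPrimeSourcedInteraction 1 t' 8 0 dWaveFormFactor (Real.sqrt 2 * (1/28 : ℝ))) 1) :
    (ω.expect (pairRegion (insert 0 unitSteps) 0) (localPairAt (insert 0 unitSteps) dWaveFormFactor 0)).re ≤
      (((353119/400000 : ℚ)) : ℝ) := by
  have hr : |(0 : ℝ) - t'| ≤ 1 / 20 := by
    rw [abs_le]; constructor <;> linarith [ht.1, ht.2]
  exact pairAmp_le_slot_on_tPrimeBox_kinematic_of_pricedNode (t'₀ := 0) (by norm_num) (by norm_num) (by norm_num)
    (by norm_num) (by norm_num) hP (energyDensityTT'_le_hi354_of_node h354) (by norm_num) hr hω hρ hmin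

/-- **`t'`-BOX CEILING from node `cert_pin1_M2_gbT_T2union_s37_U8_n7o8_tp0_g1o14_pairAmpMax_priced_j256378`** (A0′ = (8, 7/8, 0); M̃ = 1.1171693496, κ = 1.23561; anchor slot 0.7899581): for every `t' ∈ [−0.05, 0.05]` (U = 8), every translation-invariant density-7/8 minimiser of the `d`-wave-sourced energy at field `h = (√2 * (1/14 : ℝ))` has **`Re ω(P₀^d) ≤ 0.9316035`** (slot `1863207/2000000` = ⌈(M̃ + κ·2·1.6212/20)/1.41421356⌉₇; kinematic registry-only route: anchor cap #354 moved to the target at `16/π²`, target state's anchor energy `+16/π²·|Δt'|`). Premises BY NAME: the priced node (CANDIDATE, referee pending) and #354. Ceiling only; never speaks to presence; no phase sentence. -/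
theorem pin1_M2_U8_n7o8_tp0_g1o14_j256378_pairAmp_le_on_tPrimeBox_of_pricedNode
    (hP : cert_pin1_M2_gbT_T2union_s37_U8_n7o8_tp0_g1o14_pairAmpMax_priced_j256378) (h354 : cert_dbt299pair_allk)
    {t' : ℝ} (ht : t' ∈ Set.Icc (-1/20 : ℝ) (1/20))
    {ω : InfVolFermionState 2} (hω : ω.IsTranslationInvariant) (hρ : ω.density = 7 / 8)
    (hmin : ∀ ω' : InfVolFermionState 2, ω'.IsTranslationInvariant → ω'.density = 7 / 8 →
      ω.meanEnergy (hubbardTTPrimeSourcedInteraction 1 t' 8 0 dWaveFormFactor (Real.sqrt 2 * (1/14 : ℝ))) 1 ≤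
        ω'.meanEnergy (hubbardTTPrimeSourcedInteraction 1 t' 8 0 dWaveFormFactor (Real.sqrt 2 * (1/14 : ℝ))) 1) :
    (ω.expect (pairRegion (insert 0 unitSteps) 0) (localPairAt (insert 0 unitSteps) dWaveFormFactor 0)).re ≤
      (((1863207/2000000 : ℚ)) : ℝ) := by
  have hr : |(0 : ℝ) - t'| ≤ 1 / 20 := by
    rw [abs_le]; constructor <;> linarith [ht.1, ht.2]
  exact pairAmp_le_slot_on_tPrimeBox_kinematic_of_pricedNode (t'₀ := 0) (by norm_num) (by norm_num) (by norm_num)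
    (by norm_num) (by norm_num) hP (energyDensityTT'_le_hi354_of_node h354) (by norm_num) hr hω hρ hmin

/-- **`t'`-BOX CEILING from node `cert_pin1_M3_gbT_T2union_s37_U8_n7o8_tp0_g1o7_pairAmpMax_priced_j256378`** (A0′ = (8, 7/8, 0); M̃ = 1.2979740993, κ = 0.86510; anchor slot 0.9178063): for every `t' ∈ [−0.05, 0.05]` (U = 8), every translation-invariant density-7/8 minimiser of the `d`-wave-sourced energy at field `h = (√2 * (1/7 : ℝ))` has **`Re ω(P₀^d) ≤ 1.0169781`** (slot `10169781/10000000` = ⌈(M̃ + κ·2·1.6212/20)/1.41421356⌉₇; kinematic registry-only route: anchor cap #354 moved to the target at `16/π²`, target state's anchor energy `+16/π²·|Δt'|`). Premises BY NAME: the priced node (CANDIDATE, referee pending) and #354. Ceiling only; never speaks to presence; no phase sentence. -/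
theorem pin1_M3_U8_n7o8_tp0_g1o7_j256378_pairAmp_le_on_tPrimeBox_of_pricedNode
    (hP : cert_pin1_M3_gbT_T2union_s37_U8_n7o8_tp0_g1o7_pairAmpMax_priced_j256378) (h354 : cert_dbt299pair_allk)
    {t' : ℝ} (ht : t' ∈ Set.Icc (-1/20 : ℝ) (1/20))
    {ω : InfVolFermionState 2} (hω : ω.IsTranslationInvariant) (hρ : ω.density = 7 / 8)
    (hmin : ∀ ω' : InfVolFermionState 2, ω'.IsTranslationInvariant → ω'.density = 7 / 8 →
      ω.meanEnergy (hubbardTTPrimeSourcedInteraction 1 t' 8 0 dWaveFormFactor (Real.sqrt 2 * (1/7 : ℝ))) 1 ≤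
        ω'.meanEnergy (hubbardTTPrimeSourcedInteraction 1 t' 8 0 dWaveFormFactor (Real.sqrt 2 * (1/7 : ℝ))) 1) :
    (ω.expect (pairRegion (insert 0 unitSteps) 0) (localPairAt (insert 0 unitSteps) dWaveFormFactor 0)).re ≤
      (((10169781/10000000 : ℚ)) : ℝ) := by
  have hr : |(0 : ℝ) - t'| ≤ 1 / 20 := by
    rw [abs_le]; constructor <;> linarith [ht.1, ht.2]
  exact pairAmp_le_slot_on_tPrimeBox_kinematic_of_pricedNode (t'₀ := 0) (by norm_num) (by norm_num) (by norm_num)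
    (by norm_num) (by norm_num) hP (energyDensityTT'_le_hi354_of_node h354) (by norm_num) hr hω hρ hmin

/-- **`t'`-BOX CEILING from node `cert_pin1_M4_gbT_T2union_s37_U8_n7o8_tp0_g3o14_pairAmpMax_priced_j257673`** (A0′ = (8, 7/8, 0); M̃ = 1.4343869291, κ = 0.56238; anchor slot 1.0142648): for every `t' ∈ [−0.05, 0.05]` (U = 8), every translation-invariant density-7/8 minimiser of the `d`-wave-sourced energy at field `h = (√2 * (3/14 : ℝ))` has **`Re ω(P₀^d) ≤ 1.0787333`** (slot `10787333/10000000` = ⌈(M̃ + κ·2·1.6212/20)/1.41421356⌉₇; kinematic registry-only route: anchor cap #354 moved to the target at `16/π²`, target state's anchor energy `+16/π²·|Δt'|`). Premises BY NAME: the priced node (CANDIDATE, referee pending) and #354. Ceiling only; never speaks to presence; no phase sentence. -/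
theorem pin1_M4_U8_n7o8_tp0_g3o14_j257673_pairAmp_le_on_tPrimeBox_of_pricedNode
    (hP : cert_pin1_M4_gbT_T2union_s37_U8_n7o8_tp0_g3o14_pairAmpMax_priced_j257673) (h354 : cert_dbt299pair_allk)
    {t' : ℝ} (ht : t' ∈ Set.Icc (-1/20 : ℝ) (1/20))
    {ω : InfVolFermionState 2} (hω : ω.IsTranslationInvariant) (hρ : ω.density = 7 / 8)
    (hmin : ∀ ω' : InfVolFermionState 2, ω'.IsTranslationInvariant → ω'.density = 7 / 8 →
      ω.meanEnergy (hubbardTTPrimeSourcedInteraction 1 t' 8 0 dWaveFormFactor (Real.sqrt 2 * (3/14 : ℝ))) 1 ≤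
        ω'.meanEnergy (hubbardTTPrimeSourcedInteraction 1 t' 8 0 dWaveFormFactor (Real.sqrt 2 * (3/14 : ℝ))) 1) :
    (ω.expect (pairRegion (insert 0 unitSteps) 0) (localPairAt (insert 0 unitSteps) dWaveFormFactor 0)).re ≤
      (((10787333/10000000 : ℚ)) : ℝ) := by
  have hr : |(0 : ℝ) - t'| ≤ 1 / 20 := by
    rw [abs_le]; constructor <;> linarith [ht.1, ht.2]
  exact pairAmp_le_slot_on_tPrimeBox_kinematic_of_pricedNode (t'₀ := 0) (by norm_num) (by norm_num) (by norm_num)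
    (by norm_num) (by norm_num) hP (energyDensityTT'_le_hi354_of_node h354) (by norm_num) hr hω hρ hmin

/-- **`t'`-BOX CEILING from node `cert_pin1_M5_gbT_T2union_s37_U8_n7o8_tp0_g2o7_pairAmpMax_priced_j257673`** (A0′ = (8, 7/8, 0); M̃ = 1.5315882742, κ = 0.36915; anchor slot 1.0829965): for every `t' ∈ [−0.05, 0.05]` (U = 8), every translation-invariant density-7/8 minimiser of the `d`-wave-sourced energy at field `h = (√2 * (2/7 : ℝ))` has **`Re ω(P₀^d) ≤ 1.1253148`** (slot `2813287/2500000` = ⌈(M̃ + κ·2·1.6212/20)/1.41421356⌉₇; kinematic registry-only route: anchor cap #354 moved to the target at `16/π²`, target state's anchor energy `+16/π²·|Δt'|`). Premises BY NAME: the priced node (CANDIDATE, referee pending) and #354. Ceiling only; never speaks to presence; no phase sentence. -/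
theorem pin1_M5_U8_n7o8_tp0_g2o7_j257673_pairAmp_le_on_tPrimeBox_of_pricedNode
    (hP : cert_pin1_M5_gbT_T2union_s37_U8_n7o8_tp0_g2o7_pairAmpMax_priced_j257673) (h354 : cert_dbt299pair_allk)
    {t' : ℝ} (ht : t' ∈ Set.Icc (-1/20 : ℝ) (1/20))
    {ω : InfVolFermionState 2} (hω : ω.IsTranslationInvariant) (hρ : ω.density = 7 / 8)
    (hmin : ∀ ω' : InfVolFermionState 2, ω'.IsTranslationInvariant → ω'.density = 7 / 8 →
      ω.meanEnergy (hubbardTTPrimeSourcedInteraction 1 t' 8 0 dWaveFormFactor (Real.sqrt 2 * (2/7 : ℝ))) 1 ≤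
        ω'.meanEnergy (hubbardTTPrimeSourcedInteraction 1 t' 8 0 dWaveFormFactor (Real.sqrt 2 * (2/7 : ℝ))) 1) :
    (ω.expect (pairRegion (insert 0 unitSteps) 0) (localPairAt (insert 0 unitSteps) dWaveFormFactor 0)).re ≤
      (((2813287/2500000 : ℚ)) : ℝ) := by
  have hr : |(0 : ℝ) - t'| ≤ 1 / 20 := by
    rw [abs_le]; constructor <;> linarith [ht.1, ht.2]
  exact pairAmp_le_slot_on_tPrimeBox_kinematic_of_pricedNode (t'₀ := 0) (by norm_num) (by norm_num) (by norm_num)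
    (by norm_num) (by norm_num) hP (energyDensityTT'_le_hi354_of_node h354) (by norm_num) hr hω hρ hmin

end Summit.Ventures.CertifiedManyBodySolver.Certificates

end
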